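/-
Copyright (c) 2026 the pub-hodgecm-mathlib formalisation cell (harness21).  Prover seat hodgecm-mathlib-LH4-p10 (g2), req620 Track A «(D-RAM) FOUR-FRAME» squad
(MS ROAD A, Stage B lead; the B10 «seam» of REF5 R5-55 ∕ LH-ref2 (g9) #12).  2026-09-04.
-/
import Literature.NumberTheory.LocalFields.WildQuadraticDatumNormOneQuotient   -- ★ p855646∕p855667 (B0): `exists_v_sub_one_eq_pow`, `isoceles_depths`
import Literature.NumberTheory.Automorphic.UnitaryThreeFourFrameDefs            -- ★ `IsRamifiedQuadraticDatum`, `IsElementDatum`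
import HarnessLib

/-!
# Crux `H413`, MS ROAD A, STAGE B: «ELEMENT-DATUM PARITY, ISOCELES AND DEPTH BOUNDS» — the three side conditions of ★ B8's box adapter, derived from the datum

Cell `hodgecm-mathlib` (D-0151), FLOOR 0, crux item H413 = `stmt-HodgeConjecture-24833`; lane `--supports stmt-HodgeConjecture-24833 --as helper` (count-neutral).  THEOREMS ONLY.
The Stage B assembly B10 (LH4-p10 (g2) skeleton c61f53438acbd4dd) lands on ★ `F0P3cDyRamStableCountSumPlanes.stableCountSum_planes_typeZero_box_of_shift`, whose hypotheses
`hiso`, `hdn : d ≤ min nᵢ`, `h1 h2 h3 : nᵢ % 2 = d % 2` are NOT binders of the MS stub.  THIS FILE derives them from `IsRamifiedQuadraticDatum σ ϖ d t`, `IsElementDatum σ ϖ N₀ α β n₁ n₂ n₃`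
and `d ≤ N₀` (the seam flagged by REF5 R5-55 (β) ∕ LH-ref2 (g9) #12 (c)): the parity of every root depth is that of `d` because a norm-one unit of depth `≥ d` is `a∕σa` with `a` a UNIT
(★ B0 `exists_v_sub_one_eq_pow`), the third depth via the norm-one unit `β·σα = β∕α`; isoceles = ultrametric (★ B0 `isoceles_depths`).
* `pow_inj_of_uniformizer`, `mod_two_eq_of_pow_eq` — bookkeeping;
* `depth_mod_two_eq_of_isElementDatum` — `n₁ % 2 = d % 2 ∧ n₂ % 2 = d % 2 ∧ n₃ % 2 = d % 2`;
* `isoceles_of_isElementDatum` — `(n₁ = n₂ ∧ n₁ ≤ n₃) ∨ (n₁ = n₃ ∧ n₁ ≤ n₂) ∨ (n₂ = n₃ ∧ n₂ ≤ n₁)`;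
* `le_min_depth_of_isElementDatum` — `d ≤ min n₁ (min n₂ n₃)`.
HONEST LABEL.  Count-neutral; `HC_CM` is proved only modulo the 7 printed citations (2 remaining named inputs: hLiu418 = `stmt-HodgeConjecture-24832`, h413 = `stmt-HodgeConjecture-24833`) until rung 0 closes.

## References
* [Serre1979] J.-P. Serre, *Local Fields*, GTM 67 (1979), Ch. V §3 (units of a ramified quadratic extension).
* [Rogawski1990] J. D. Rogawski, *Automorphic Representations of Unitary Groups in Three Variables*, Ann. of Math. Stud. 123 (1990), §4.9 p. 55 (root depths of a near-identity torus element).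
-/

set_option autoImplicit false

noncomputable section

namespace Summit.HodgeConjecture.HodgeConjecture.Cruxes.H413.F0P3cDyRamElementDatumParity

open WithZero
open Literature.NumberTheory.Automorphic Literature.NumberTheory.Automorphic.UnitaryThreeFourFrame
open Literature.NumberTheory.LocalFields.WildQuadraticDatum
open scoped Valued

variable {K : Type} [Field K] [Valued K ℤᵐ⁰]

/-- `n ↦ |ϖ|ⁿ` is injective for `|ϖ| = exp(−1)`. [cite: Serre1979, Ch. V §3] -/
theorem pow_inj_of_uniformizer {ϖ : K} (hϖ : Valued.v ϖ = exp (-1 : ℤ)) {m n : ℕ} (h : Valued.v ϖ ^ m = Valued.v ϖ ^ n) : m = n := by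
  rw [hϖ, ← exp_nsmul, ← exp_nsmul] at h
  have := exp_injective h
  simp only [nsmul_eq_mul, mul_neg, mul_one, neg_inj, Nat.cast_inj] at this
  exact this

/-- If `|x| = |ϖ|ⁿ` and `|x| = |ϖ|^{d+2j}` then `n % 2 = d % 2`. [cite: Serre1979, Ch. V §3] -/
theorem mod_two_eq_of_pow_eq {ϖ : K} (hϖ : Valued.v ϖ = exp (-1 : ℤ)) {x : K} {n d j : ℕ}
    (hn : Valued.v x = Valued.v ϖ ^ n) (hj : Valued.v x = Valued.v ϖ ^ (d + 2 * j)) : n % 2 = d % 2 := by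
  have := pow_inj_of_uniformizer hϖ (hn.symm.trans hj)
  omega

/-- **ROOT DEPTHS HAVE THE PARITY OF `d`** for an element datum at threshold `N₀ ≥ d`. [cite: Serre1979, Ch. V §3] [cite: Rogawski1990, §4.9 p. 55] -/
theorem depth_mod_two_eq_of_isElementDatum {σ : K →+* K} {ϖ : K} {d t : ℕ} (hD : IsRamifiedQuadraticDatum σ ϖ d t)
    {α β : K} {N₀ n₁ n₂ n₃ : ℕ} (hE : IsElementDatum σ ϖ N₀ α β n₁ n₂ n₃) (hN₀ : d ≤ N₀) :
    n₁ % 2 = d % 2 ∧ n₂ % 2 = d % 2 ∧ n₃ % 2 = d % 2 := by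
  obtain ⟨hσ, hvσ, hϖ, hfix, hd, hd1, -⟩ := hD
  obtain ⟨hα, hβ, hαβ, hα1, hβ1, h₁, h₂, h₃, hN₁, hN₂, hN₃⟩ := hE
  have hϖ1 : Valued.v ϖ ≤ 1 := by rw [hϖ]; exact le_of_lt (exp_lt_exp.2 (by norm_num) |>.trans_eq exp_zero)
  have hanti : ∀ {m n : ℕ}, m ≤ n → Valued.v ϖ ^ n ≤ Valued.v ϖ ^ m := fun h => pow_le_pow_right_of_le_one' hϖ1 h
  -- `β`: depth `n₁ ≥ N₀ ≥ d`
  have p₁ : n₁ % 2 = d % 2 := by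
    obtain ⟨j, hj⟩ := exists_v_sub_one_eq_pow hσ hvσ hfix hϖ hd hd1 hβ (by rw [h₁]; exact hanti (hN₀.trans hN₁)) hβ1
    exact mod_two_eq_of_pow_eq hϖ h₁ hj
  have p₂ : n₂ % 2 = d % 2 := by
    obtain ⟨j, hj⟩ := exists_v_sub_one_eq_pow hσ hvσ hfix hϖ hd hd1 hα (by rw [h₂]; exact hanti (hN₀.trans hN₂)) hα1
    exact mod_two_eq_of_pow_eq hϖ h₂ hj
  -- `γ := β·σα = β∕α` is norm-one with `|γ − 1| = |α − β|`
  have hα0 : α ≠ 0 := fun h => by rw [h, zero_mul] at hα; exact zero_ne_one hα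
  have hvα : Valued.v α = 1 := by
    have h2 := congrArg Valued.v hα
    rw [map_mul, hvσ, map_one] at h2
    have hv0 : Valued.v α ≠ 0 := (Valuation.ne_zero_iff _).2 hα0
    rcases lt_trichotomy (Valued.v α) 1 with hlt | heq | hgt
    · exact absurd h2 (ne_of_lt (by simpa using mul_lt_one_of_nonneg_of_lt_one_left zero_le hlt hlt.le))
    · exact heq
    · exact absurd h2 (ne_of_gt (by simpa using one_lt_mul_of_lt_of_le' hgt hgt.le))
  have hγ : (β * σ α) * σ (β * σ α) = 1 := by
    rw [map_mul, hσ]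
    calc β * σ α * (σ β * α) = (α * σ α) * (β * σ β) := by ring
      _ = 1 := by rw [hα, hβ, one_mul]
  have hγ1 : β * σ α ≠ 1 := by
    intro h
    apply hαβ
    have : β * σ α * α = α := by rw [h, one_mul]
    rw [mul_assoc, mul_comm (σ α) α, hα, mul_one] at this
    exact this.symm
  have hvγ : Valued.v (β * σ α - 1) = Valued.v ϖ ^ n₃ := by
    have e : β * σ α - 1 = -σ α * (α - β) := by
      have : σ α * α = 1 := by rw [mul_comm, hα]
      linear_combination this
    rw [e, map_mul, Valuation.map_neg, hvσ, hvα, one_mul, h₃]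
  have p₃ : n₃ % 2 = d % 2 := by
    obtain ⟨j, hj⟩ := exists_v_sub_one_eq_pow hσ hvσ hfix hϖ hd hd1 hγ (by rw [hvγ]; exact hanti (hN₀.trans hN₃)) hγ1
    exact mod_two_eq_of_pow_eq hϖ hvγ hj
  exact ⟨p₁, p₂, p₃⟩

/-- **ISOCELES** in ★ B8's shape. [cite: Rogawski1990, §4.9 p. 55] -/
theorem isoceles_of_isElementDatum {σ : K →+* K} {ϖ : K} {d t : ℕ} (hD : IsRamifiedQuadraticDatum σ ϖ d t)
    {α β : K} {N₀ n₁ n₂ n₃ : ℕ} (hE : IsElementDatum σ ϖ N₀ α β n₁ n₂ n₃) :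
    (n₁ = n₂ ∧ n₁ ≤ n₃) ∨ (n₁ = n₃ ∧ n₁ ≤ n₂) ∨ (n₂ = n₃ ∧ n₂ ≤ n₁) := by
  obtain ⟨-, -, hϖ, -⟩ := hD
  obtain ⟨-, -, -, -, -, h₁, h₂, h₃, -⟩ := hE
  obtain ⟨i, ii, iii⟩ := isoceles_depths hϖ h₁ h₂ h₃
  omega

/-- **`d ≤ min nᵢ`** (threshold `N₀ ≥ d`). [cite: Rogawski1990, §4.9 p. 55] -/
theorem le_min_depth_of_isElementDatum {σ : K →+* K} {ϖ : K} {α β : K} {N₀ n₁ n₂ n₃ d : ℕ} (hE : IsElementDatum σ ϖ N₀ α β n₁ n₂ n₃) (hN₀ : d ≤ N₀) :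
    d ≤ min n₁ (min n₂ n₃) := by
  obtain ⟨-, -, -, -, -, -, -, -, hN₁, hN₂, hN₃⟩ := hE
  omega

end Summit.HodgeConjecture.HodgeConjecture.Cruxes.H413.F0P3cDyRamElementDatumParity

end
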